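import Summits.HodgeConjecture.HodgeConjecture.Theorems.F0P6aSigmaGALSockets   -- ★ PART A of the same Lines workfile (size-lint split; same namespace `Summit.HodgeConjecture.HodgeConjecture.Cruxes.HLiu418.F0P6aSigmaGAL`)
import HarnessLib

/-!
# ★ RE-HOME — PART B (size lint: `Theorems/` files with proofs are ≤ 400 lines) of the Lines workfile whose PART A is `Theorems/F0P6aSigmaGALSockets.lean`.

Same namespace `Summit.HodgeConjecture.HodgeConjecture.Cruxes.HLiu418.F0P6aSigmaGAL` (every fully-qualified name unchanged); the preamble (options, `noncomputable section`, top-level `open`s) is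
repeated verbatim from Part A; the code below is the remainder of the tree bytes, untouched.  See Part A for the ★ re-home header and the original module
docstring.  HC_CM is proved only modulo the 7 printed citations (2 remaining: hLiu418 = stmt-HodgeConjecture-24832, h413 = stmt-HodgeConjecture-24833) until rung 0 closes.
-/


set_option autoImplicit false

noncomputable section

namespace Summit.HodgeConjecture.HodgeConjecture.Cruxes.HLiu418.F0P6aSigmaGAL

set_option linter.dupNamespace false

open CategoryTheory CategoryTheory.Limits NumberField IsDedekindDomain MulAction Matrix AlgebraicGeometry
open scoped Matrix ComplexOrder Polynomial MonObj
open Literature.AlgebraicGeometry.Motives (SchemeOver AlgPoints ComplexPoints specOver)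
open Literature.AlgebraicGeometry.Motives.AbelianVariety (bcSpec)
open Literature.AlgebraicGeometry.Motives.GaloisDescent (gal bc gal_fst gal_snd)
open Literature.AlgebraicGeometry.Motives.AbelianVariety (specAut specAut_mul specAut_one specAut_comp_bcSpec)
open Literature.AlgebraicGeometry.AbelianSchemes (PolarizedAbelianSchemeWithLevel AbelianSchemeOver)
open Literature.AlgebraicGeometry.ModuliOfAbelianVarieties
open Literature.AlgebraicGeometry.ShimuraVarieties Literature.AlgebraicGeometry.ShimuraVarieties.UnitaryCanonicalModel
open Literature.NumberTheory.Automorphic Literature.NumberTheory.Automorphic.UnitaryGroup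
open Literature.NumberTheory.Automorphic.Liu2021.AppendixC (C5.OpenCompactSubgroup C5.SmallLevel)
open Literature.Geometry.Kaehler (ComplexTorus)
open Summit.HodgeConjecture.HodgeConjecture.Cruxes.HLiu418.F0P6aPELWitnessE (GSAdele IsCMTypeThrough mOf AuxChartGS)
open Literature.AlgebraicGeometry.ShimuraVarieties.UnitaryCurve (exists_mover_of_mk_eq_mk_frame)
open Summit.HodgeConjecture.HodgeConjecture.Theorems.F0P6aCMHomKernelShape (exists_cmConjHom_kernelShape_frame_of_restrictScalars)

/-! ## §3 THE HEAD: Σ-GAL from Σ-AN readings and the CM kernel inputs -/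

section Head

variable {F : Type} [Field F] [NumberField F] [IsCMField F] {ι₁ : F →+* ℂ} {Jstar : Matrix (Fin 2) (Fin 2) F}
  {K₀ : C5.OpenCompactSubgroup (GSAdele F Jstar)} {S : RecordSystemGS F Jstar ι₁ K₀} {Kc : C5.SmallLevel K₀}
  {Fi : Type} [Field Fi] [NumberField Fi] [Algebra F Fi] {τE : Fi →+* ℂ} {Φ : Set (F →+* ℂ)}

set_option backward.isDefEq.respectTransparency false in
set_option maxHeartbeats 400000 in -- one declaration threading H0 ∕ σ1×2 ∕ H1×2 ∕ KERNEL ∕ G2a ∕ G2b-α (cell cap)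
/-- **THE FIBRE IDENTITY AT A SPECIAL POINT OF EVERY CONNECTED COMPONENT** (the `h` of ★ B-γ for the canonical `galA`), from Σ-AN `ReadsCReading` and
the CM kernel inputs `KCMInputs`: ★ H0 (special honest point), σ1 at it and at its `σ`-twist, ★ H1 ×2, ★ unit-frame torsion readings, ★ KERNEL ED. 3,
★ G2b-α, ★ G2a. [cite: Milne2005ShimuraVarieties, §14 Prop. 14.12 p. 125; §13 Prop. 13.1 p. 117] [cite: MumfordFogartyKirwan1994, Ch. 6 §1 Corollary 6.2 (p. 116)] -/
theorem exists_fieldPoint_fibre_comp_galA_eq (hτE : τE.comp (algebraMap F Fi) = ι₁) (C : AuxChartGS F ι₁ Jstar K₀ S Kc Fi τE Φ)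
    (ε : (Literature.AlgebraicGeometry.Motives.baseChange F Fi).obj (S.M.obj Kc) ⟶
        (Literature.AlgebraicGeometry.Motives.baseChange ℚ Fi).obj C.𝓜.M)
    (Y : letI : Algebra Fi ℂ := τE.toAlgebra
      𝓞 F → (((C.𝓜.univ.baseChange (ε.left ≫ pullback.fst C.𝓜.M.hom (bcSpec ℚ Fi))).A.baseChange
        (pullback.fst ((Literature.AlgebraicGeometry.Motives.baseChange F Fi).obj (S.M.obj Kc)).hom (bcSpec Fi ℂ))).X ⟶
        ((C.𝓜.univ.baseChange (ε.left ≫ pullback.fst C.𝓜.M.hom (bcSpec ℚ Fi))).A.baseChange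
        (pullback.fst ((Literature.AlgebraicGeometry.Motives.baseChange F Fi).obj (S.M.obj Kc)).hom (bcSpec Fi ℂ))).X))
    (hY : letI : Algebra Fi ℂ := τE.toAlgebra; ∀ b, IsMonHom (Y b)) (hR : ReadsCReading C ε Y hY) (hKc : KCMInputs C ε Y hY)
    (b : 𝓞 F) (σ : letI : Algebra Fi ℂ := τE.toAlgebra; ℂ ≃ₐ[Fi] ℂ)
    (x0 : letI : Algebra Fi ℂ := τE.toAlgebra; ↥(bc ℂ ((Literature.AlgebraicGeometry.Motives.baseChange F Fi).obj (S.M.obj Kc)))) :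
    letI P := C.𝓜.univ.baseChange (ε.left ≫ pullback.fst C.𝓜.M.hom (bcSpec ℚ Fi))
    letI X := (Literature.AlgebraicGeometry.Motives.baseChange F Fi).obj (S.M.obj Kc)
    letI : Algebra Fi ℂ := τE.toAlgebra
    ∃ (L : Type) (_ : Field L) (s : Spec (.of L) ⟶ bc ℂ X),
      s.base (IsLocalRing.closedPoint L) ∈ connectedComponent x0 ∧
        pullback.fst (pullback.snd P.A.X.hom (pullback.fst X.hom (bcSpec Fi ℂ))) s ≫ (Y b).left ≫
            pullback.map P.A.X.hom (pullback.fst X.hom (bcSpec Fi ℂ)) P.A.X.hom (pullback.fst X.hom (bcSpec Fi ℂ)) (𝟙 P.A.X.left)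
              (gal ℂ X σ) (𝟙 X.left) (by rw [Category.comp_id, Category.id_comp]) (by rw [Category.comp_id, gal_fst]) =
          pullback.fst (pullback.snd P.A.X.hom (pullback.fst X.hom (bcSpec Fi ℂ))) s ≫
            pullback.map P.A.X.hom (pullback.fst X.hom (bcSpec Fi ℂ)) P.A.X.hom (pullback.fst X.hom (bcSpec Fi ℂ)) (𝟙 P.A.X.left)
              (gal ℂ X σ) (𝟙 X.left) (by rw [Category.comp_id, Category.id_comp]) (by rw [Category.comp_id, gal_fst]) ≫ (Y b).left := by
  letI : Algebra Fi ℂ := τE.toAlgebra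
  letI : Algebra F ℂ := ι₁.toAlgebra
  haveI : IsScalarTower F Fi ℂ := IsScalarTower.of_algebraMap_eq fun x => by
    change ι₁ x = τE (algebraMap F Fi x)
    rw [← hτE]; rfl
  let P := C.𝓜.univ.baseChange (ε.left ≫ pullback.fst C.𝓜.M.hom (bcSpec ℚ Fi))
  let X := (Literature.AlgebraicGeometry.Motives.baseChange F Fi).obj (S.M.obj Kc)
  haveI : IsMonHom (Y b) := hY b
  haveI : IsSeparated (S.M.obj Kc).hom := (S.projective Kc).isProper.toIsSeparated
  haveI : IsSeparated X.hom := by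
    change IsSeparated (pullback.snd (S.M.obj Kc).hom (bcSpec F Fi))
    exact MorphismProperty.pullback_snd (P := @IsSeparated) _ _ inferInstance
  -- ★ H0: an honest special point `P₀` of `Xc` in the component of `x0`, flat over `[ι₁ w, a₀]`
  have h0 := UnitaryCanonicalModel.RecordSystemGS.exists_specialPoint_pt_mem_connectedComponent_tower S Kc τE hτE x0
  obtain ⟨w, hw, a₀, P₀, -, hbase, hflat⟩ := h0
  refine ⟨ℂ, inferInstance, P₀.left, hbase, ?_⟩
  -- honesty of `P₀.left`
  have hx : P₀.left ≫ pullback.snd X.hom (bcSpec Fi ℂ) = 𝟙 _ := by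
    have h := Over.w P₀
    refine h.trans ?_
    change Spec.map (CommRingCat.ofHom (algebraMap ℂ ℂ)) = _
    rw [Algebra.algebraMap_self, CommRingCat.ofHom_id]
    exact Spec.map_id _
  -- the complex point of `X` under `P₀` and its flat special point
  have hxpt : (P₀.left ≫ pullback.fst X.hom (bcSpec Fi ℂ)) ≫ X.hom = (specOver Fi ℂ).hom :=
    calc (P₀.left ≫ pullback.fst X.hom (bcSpec Fi ℂ)) ≫ X.hom
        = P₀.left ≫ pullback.fst X.hom (bcSpec Fi ℂ) ≫ X.hom := Category.assoc _ _ _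
      _ = P₀.left ≫ pullback.snd X.hom (bcSpec Fi ℂ) ≫ bcSpec Fi ℂ := congrArg (P₀.left ≫ ·) pullback.condition
      _ = (P₀.left ≫ pullback.snd X.hom (bcSpec Fi ℂ)) ≫ bcSpec Fi ℂ := (Category.assoc _ _ _).symm
      _ = 𝟙 _ ≫ bcSpec Fi ℂ := congrArg (· ≫ bcSpec Fi ℂ) hx
      _ = (specOver Fi ℂ).hom := Category.id_comp _
  let xpt : ComplexPoints X := Over.homMk (P₀.left ≫ pullback.fst X.hom (bcSpec Fi ℂ)) hxpt
  let Pflat : ComplexPoints (S.M.obj Kc) := (S.pts Kc).symm (ShimuraSetGS.mk F Jstar ι₁ Kc.1.1 (fun i => ι₁ (w i)) hw a₀)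
  have hflatₛ : (P₀.left ≫ pullback.fst X.hom (bcSpec Fi ℂ)) ≫ pullback.fst (S.M.obj Kc).hom (bcSpec F Fi) = Pflat.left := by
    rw [Category.assoc]; exact hflat
  -- σ1 at the special point, principal representative `(C.u c, C.rep c)`
  have hR₁ := hR xpt Pflat hflatₛ.symm
  obtain ⟨v, hv, a, hpts, hσ1⟩ := hR₁
  have hσ1₁ := hσ1 (C.u (C.piece a)) (C.rep (C.piece a))
    (C.rep_spec (C.piece a)).1 (C.rep_spec (C.piece a)).2.1 (C.rep_spec (C.piece a)).2.2.1
    (C.rep_spec (C.piece a)).2.2.2.1 (C.rep_spec (C.piece a)).2.2.2.2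
  obtain ⟨m₁, Θ₁, Λ₁, hamp₁, hΘl₁, hΛ₁, hγ₁, hΨ₁, hread₁⟩ := hσ1₁
  -- the twisted honest point `x' := Spec σ ≫ P₀ ≫ gal σ`, its base point `s' := Spec σ ≫ P₀ ≫ prX`
  have hx' : (specAut ℂ σ ≫ P₀.left ≫ gal ℂ X σ) ≫ pullback.snd X.hom (bcSpec Fi ℂ) = 𝟙 _ :=
    calc (specAut ℂ σ ≫ P₀.left ≫ gal ℂ X σ) ≫ pullback.snd X.hom (bcSpec Fi ℂ)
        = specAut ℂ σ ≫ P₀.left ≫ gal ℂ X σ ≫ pullback.snd X.hom (bcSpec Fi ℂ) := by simp only [Category.assoc]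
      _ = specAut ℂ σ ≫ P₀.left ≫ pullback.snd X.hom (bcSpec Fi ℂ) ≫ specAut ℂ σ⁻¹ :=
          congrArg (fun t => specAut ℂ σ ≫ P₀.left ≫ t) (gal_snd ℂ X σ)
      _ = specAut ℂ σ ≫ specAut ℂ σ⁻¹ :=
          congrArg (specAut ℂ σ ≫ ·)
            ((Category.assoc _ _ _).symm.trans (((congrArg (· ≫ specAut ℂ σ⁻¹) hx)).trans (Category.id_comp _)))
      _ = 𝟙 _ := by rw [← specAut_mul, mul_inv_cancel, specAut_one]
  have hxs' : (specAut ℂ σ ≫ P₀.left ≫ gal ℂ X σ) ≫ pullback.fst X.hom (bcSpec Fi ℂ) =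
      AbelianSchemeOver.specTwist σ.toRingEquiv ≫ P₀.left ≫ pullback.fst X.hom (bcSpec Fi ℂ) :=
    calc (specAut ℂ σ ≫ P₀.left ≫ gal ℂ X σ) ≫ pullback.fst X.hom (bcSpec Fi ℂ)
        = specAut ℂ σ ≫ P₀.left ≫ gal ℂ X σ ≫ pullback.fst X.hom (bcSpec Fi ℂ) := by simp only [Category.assoc]
      _ = specAut ℂ σ ≫ P₀.left ≫ pullback.fst X.hom (bcSpec Fi ℂ) :=
          congrArg (fun t => specAut ℂ σ ≫ P₀.left ≫ t) (gal_fst ℂ X σ)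
      _ = AbelianSchemeOver.specTwist σ.toRingEquiv ≫ P₀.left ≫ pullback.fst X.hom (bcSpec Fi ℂ) := rfl
  have hx'pt : (AbelianSchemeOver.specTwist σ.toRingEquiv ≫ P₀.left ≫ pullback.fst X.hom (bcSpec Fi ℂ)) ≫ X.hom =
      (specOver Fi ℂ).hom :=
    calc (AbelianSchemeOver.specTwist σ.toRingEquiv ≫ P₀.left ≫ pullback.fst X.hom (bcSpec Fi ℂ)) ≫ X.hom
        = AbelianSchemeOver.specTwist σ.toRingEquiv ≫ (P₀.left ≫ pullback.fst X.hom (bcSpec Fi ℂ)) ≫ X.hom := by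
          simp only [Category.assoc]
      _ = AbelianSchemeOver.specTwist σ.toRingEquiv ≫ (specOver Fi ℂ).hom :=
          congrArg (AbelianSchemeOver.specTwist σ.toRingEquiv ≫ ·) hxpt
      _ = (specOver Fi ℂ).hom := specAut_comp_bcSpec ℂ σ
  let x'pt : ComplexPoints X := Over.homMk (AbelianSchemeOver.specTwist σ.toRingEquiv ≫ P₀.left ≫ pullback.fst X.hom (bcSpec Fi ℂ)) hx'pt
  have hPflat' : (AbelianSchemeOver.specTwist σ.toRingEquiv ≫ Pflat.left) ≫ (S.M.obj Kc).hom = (specOver F ℂ).hom :=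
    calc (AbelianSchemeOver.specTwist σ.toRingEquiv ≫ Pflat.left) ≫ (S.M.obj Kc).hom
        = AbelianSchemeOver.specTwist σ.toRingEquiv ≫ Pflat.left ≫ (S.M.obj Kc).hom := Category.assoc _ _ _
      _ = AbelianSchemeOver.specTwist σ.toRingEquiv ≫ (specOver F ℂ).hom :=
          congrArg (AbelianSchemeOver.specTwist σ.toRingEquiv ≫ ·) (Over.w Pflat)
      _ = (specOver F ℂ).hom := specAut_comp_bcSpec ℂ (σ.restrictScalars F)
  let Pflat' : ComplexPoints (S.M.obj Kc) := Over.homMk (AbelianSchemeOver.specTwist σ.toRingEquiv ≫ Pflat.left) hPflat'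
  have hflat' : Pflat'.left = x'pt.left ≫ pullback.fst (S.M.obj Kc).hom (bcSpec F Fi) :=
    calc Pflat'.left = AbelianSchemeOver.specTwist σ.toRingEquiv ≫ Pflat.left := rfl
      _ = AbelianSchemeOver.specTwist σ.toRingEquiv ≫ (P₀.left ≫ pullback.fst X.hom (bcSpec Fi ℂ)) ≫
            pullback.fst (S.M.obj Kc).hom (bcSpec F Fi) :=
          congrArg (AbelianSchemeOver.specTwist σ.toRingEquiv ≫ ·) hflatₛ.symm
      _ = (AbelianSchemeOver.specTwist σ.toRingEquiv ≫ P₀.left ≫ pullback.fst X.hom (bcSpec Fi ℂ)) ≫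
            pullback.fst (S.M.obj Kc).hom (bcSpec F Fi) := by
          simp only [Category.assoc]
  have hR₂ := hR x'pt Pflat' hflat'
  obtain ⟨v', hv', a', hpts', hσ1'⟩ := hR₂
  have hσ1₂ := hσ1' (C.u (C.piece a')) (C.rep (C.piece a'))
    (C.rep_spec (C.piece a')).1 (C.rep_spec (C.piece a')).2.1 (C.rep_spec (C.piece a')).2.2.1
    (C.rep_spec (C.piece a')).2.2.2.1 (C.rep_spec (C.piece a')).2.2.2.2
  obtain ⟨m₂, Θ₂, Λ₂, hamp₂, hΘl₂, hΛ₂, hγ₂, hΨ₂, hread₂⟩ := hσ1₂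
  -- the CM kernel inputs (the socket)
  have hK₀ := hKc b σ (P₀.left ≫ pullback.fst X.hom (bcSpec Fi ℂ)) w hw a₀ Pflat rfl hflatₛ v hv a hpts m₁ Θ₁ Λ₁
    hamp₁ hΘl₁ hΛ₁ hγ₁ hΨ₁ Pflat' rfl v' hv' a' hpts' m₂ Θ₂ Λ₂ hamp₂ hΘl₂ hΛ₂ hγ₂ hΨ₂
  obtain ⟨f, k, hk, hf, hℓ⟩ := hK₀
  -- ★ H1: the fibre readings `y`, `y'` of `Y b` at the two honest points
  have hH1 := AbelianSchemeOver.exists_fibre_hom_reads_baseChange_endomorphism P.A (pullback.fst X.hom (bcSpec Fi ℂ)) P₀.left (Y b)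
  obtain ⟨y, hready⟩ := hH1
  have hH1' := AbelianSchemeOver.exists_fibre_hom_reads_baseChange_endomorphism_of_comp_eq P.A (pullback.fst X.hom (bcSpec Fi ℂ))
    (specAut ℂ σ ≫ P₀.left ≫ gal ℂ X σ) (Y b) (AbelianSchemeOver.specTwist σ.toRingEquiv ≫ P₀.left ≫ pullback.fst X.hom (bcSpec Fi ℂ)) hxs'
  obtain ⟨y', hready'⟩ := hH1'
  -- torus readings (§3a), then torsion readings (★ unit-frame organ)
  have hEQT := map_toFun_eq_mapMatrix_of_readings P.A (pullback.fst X.hom (bcSpec Fi ℂ)) (pullback.snd X.hom (bcSpec Fi ℂ)) (Y b).left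
    P₀.left hx (P₀.left ≫ pullback.fst X.hom (bcSpec Fi ℂ)) rfl m₁ y (C.Mρ a b) hready (hread₁ b)
  have hEQT' := map_toFun_eq_mapMatrix_of_readings P.A (pullback.fst X.hom (bcSpec Fi ℂ)) (pullback.snd X.hom (bcSpec Fi ℂ)) (Y b).left
    (specAut ℂ σ ≫ P₀.left ≫ gal ℂ X σ) hx' _ hxs' m₂ y' (C.Mρ a' b) hready' (hread₂ b)
  have hy : ∀ v₀ : Fin C.g ⊕ Fin C.g → ℚ, AlgPoints.map y.hom.hom.hom (m₁.r v₀) = m₁.r (((C.Mρ a b).map (Int.cast : ℤ → ℚ)) *ᵥ v₀) :=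
    fun v₀ => SiegelAdelicMarking.map_r_eq_of_map_toFun_mapMatrix m₁ hγ₁ y (C.Mρ a b) hEQT v₀
  have hy' : ∀ w₀ : Fin C.g ⊕ Fin C.g → ℚ, AlgPoints.map y'.hom.hom.hom (m₂.r w₀) = m₂.r (((C.Mρ a' b).map (Int.cast : ℤ → ℚ)) *ᵥ w₀) :=
    fun w₀ => SiegelAdelicMarking.map_r_eq_of_map_toFun_mapMatrix m₂ hγ₂ y' (C.Mρ a' b) hEQT' w₀
  -- ★ KERNEL ED. 3: the intertwining
  have hint := SiegelAdelicMarking.conjugate_comp_conjFibreIso_eq_of_lifts_of_hom C.hg C.hδ C.hN (σ.restrictScalars ℚ)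
    hΘl₁ Λ₁ m₁ hΛ₁ (C.rep_spec (C.piece a')).2.2.1 (C.Z_mem a' v' hv') m₂ Λ₂ hΘl₂ hΛ₂ f hk hf
    ((C.Mρ a b).map (Int.cast : ℤ → ℚ)) ((C.Mρ a' b).map (Int.cast : ℤ → ℚ)) hℓ y hy y' hy'
  -- ★ G2a ⇐ ★ G2b-α
  refine AbelianSchemeOver.fibre_comp_galA_eq_of_forall_point' P.A _
    (fun σ => (AbelianSchemeOver.pullbackMap_gal_fst_snd P.A σ).1) (fun σ => (AbelianSchemeOver.pullbackMap_gal_fst_snd P.A σ).2)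
    σ (Y b).left (Over.w (Y b)) P₀.left hx ?_
  intro q hq
  exact AbelianSchemeOver.forall_point_comp_galA_of_conjugate_comp_eq P.A _
    (fun σ => (AbelianSchemeOver.pullbackMap_gal_fst_snd P.A σ).1) (fun σ => (AbelianSchemeOver.pullbackMap_gal_fst_snd P.A σ).2)
    σ (Y b).left P₀.left y y' hready hready' hint q hq

end Head

set_option maxHeartbeats 400000 in -- B-γ over the full letter context
/-- **Σ-GAL — `ReadsCReading → ReadsCGalois` (the `hGAL` binder of A-p06 (g33)'s closer v7 `stub_E6_of_junction_sigmaAN_sigmaGAL`), from the socket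
`stub_KCM` alone; composition over ★ B-γ `forall_gal_comp_eq_of_forall_exists_fieldPoint` (one field point per connected component: my ★ H0, the
special point `[ι₁w, a₀K]` of the τE-thickened curve) and `exists_fieldPoint_fibre_comp_galA_eq` above.**
[cite: Milne2005ShimuraVarieties, §13 Prop. 13.1 p. 117; §14 Prop. 14.12 p. 125] [cite: MumfordFogartyKirwan1994, Ch. 6 §1 Corollary 6.2 (p. 116)] -/
theorem readsCGalois_of_readsCReading
    (hK : ∀ (F : Type) [Field F] [NumberField F] [IsCMField F] [IsGalois ℚ F] (ι₁ : F →+* ℂ)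
      (Jstar : Matrix (Fin 2) (Fin 2) F) (_hJ : (Jstar.map (IsCMField.complexConj F))ᵀ = Jstar) (_hJu : IsUnit Jstar)
      (K₀ : C5.OpenCompactSubgroup (GSAdele F Jstar)) (S : RecordSystemGS F Jstar ι₁ K₀) (Kc : C5.SmallLevel K₀)
      (Fi : Type) [Field Fi] [NumberField Fi] [Algebra F Fi] [IsGalois F Fi] (τE : Fi →+* ℂ) (_hτE : τE.comp (algebraMap F Fi) = ι₁)
      (Φ : Set (F →+* ℂ)) (_hΦ : IsCMTypeThrough ι₁ Φ) (C : AuxChartGS F ι₁ Jstar K₀ S Kc Fi τE Φ)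
      (ε : (Literature.AlgebraicGeometry.Motives.baseChange F Fi).obj (S.M.obj Kc) ⟶
          (Literature.AlgebraicGeometry.Motives.baseChange ℚ Fi).obj C.𝓜.M)
      (_hε : letI : Algebra Fi ℂ := τE.toAlgebra
        ∀ (P : ComplexPoints ((Literature.AlgebraicGeometry.Motives.baseChange F Fi).obj (S.M.obj Kc)))
          (Pflat : letI : Algebra F ℂ := ι₁.toAlgebra; ComplexPoints (S.M.obj Kc)),
          Pflat.left = P.left ≫ pullback.fst (S.M.obj Kc).hom (bcSpec F Fi) →
          (AlgPoints.map ε P).left ≫ pullback.fst C.𝓜.M.hom (bcSpec ℚ Fi) =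
            (letI : Algebra F ℂ := ι₁.toAlgebra; (C.f (S.pts Kc Pflat)).left))
      (_hU : Literature.AlgebraicGeometry.ModuliOfAbelianVarieties.siegelUniversalFamilyUniformisation),

      ∀ Y hY, ReadsCReading C ε Y hY → KCMInputs C ε Y hY) :
    ∀ (F : Type) [Field F] [NumberField F] [IsCMField F] [IsGalois ℚ F] (ι₁ : F →+* ℂ)
      (Jstar : Matrix (Fin 2) (Fin 2) F) (_hJ : (Jstar.map (IsCMField.complexConj F))ᵀ = Jstar) (_hJu : IsUnit Jstar)
      (K₀ : C5.OpenCompactSubgroup (GSAdele F Jstar)) (S : RecordSystemGS F Jstar ι₁ K₀) (Kc : C5.SmallLevel K₀)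
      (Fi : Type) [Field Fi] [NumberField Fi] [Algebra F Fi] [IsGalois F Fi] (τE : Fi →+* ℂ) (_hτE : τE.comp (algebraMap F Fi) = ι₁)
      (Φ : Set (F →+* ℂ)) (_hΦ : IsCMTypeThrough ι₁ Φ) (C : AuxChartGS F ι₁ Jstar K₀ S Kc Fi τE Φ)
      (ε : (Literature.AlgebraicGeometry.Motives.baseChange F Fi).obj (S.M.obj Kc) ⟶
          (Literature.AlgebraicGeometry.Motives.baseChange ℚ Fi).obj C.𝓜.M)
      (_hε : letI : Algebra Fi ℂ := τE.toAlgebra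
        ∀ (P : ComplexPoints ((Literature.AlgebraicGeometry.Motives.baseChange F Fi).obj (S.M.obj Kc)))
          (Pflat : letI : Algebra F ℂ := ι₁.toAlgebra; ComplexPoints (S.M.obj Kc)),
          Pflat.left = P.left ≫ pullback.fst (S.M.obj Kc).hom (bcSpec F Fi) →
          (AlgPoints.map ε P).left ≫ pullback.fst C.𝓜.M.hom (bcSpec ℚ Fi) =
            (letI : Algebra F ℂ := ι₁.toAlgebra; (C.f (S.pts Kc Pflat)).left))
      (_hU : Literature.AlgebraicGeometry.ModuliOfAbelianVarieties.siegelUniversalFamilyUniformisation),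

      ∀ Y hY, ReadsCReading C ε Y hY → ReadsCGalois C ε Y hY := by
  intro F _ _ _ _ ι₁ Jstar hJ hJu K₀ S Kc Fi _ _ _ _ τE hτE Φ hΦ C ε hε hU Y hY hR
  letI : Algebra Fi ℂ := τE.toAlgebra
  intro b σ
  have hKc := hK F ι₁ Jstar hJ hJu K₀ S Kc Fi τE hτE Φ hΦ C ε hε hU Y hY hR
  -- finiteness: `X` and `X_ℂ` are locally Noetherian (as in A-p06 (g33)'s closer v7)
  haveI := S.smooth Kc
  haveI : Smooth (S.M.obj Kc).hom := SmoothOfRelativeDimension.smooth 1 _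
  haveI hXsm : Smooth ((Literature.AlgebraicGeometry.Motives.baseChange F Fi).obj (S.M.obj Kc)).hom := by
    change Smooth (pullback.snd (S.M.obj Kc).hom _)
    infer_instance
  haveI : IsLocallyNoetherian ((Literature.AlgebraicGeometry.Motives.baseChange F Fi).obj (S.M.obj Kc)).left :=
    LocallyOfFiniteType.isLocallyNoetherian ((Literature.AlgebraicGeometry.Motives.baseChange F Fi).obj (S.M.obj Kc)).hom
  haveI : IsLocallyNoetherian (bc ℂ ((Literature.AlgebraicGeometry.Motives.baseChange F Fi).obj (S.M.obj Kc))) :=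
    LocallyOfFiniteType.isLocallyNoetherian
      (pullback.snd ((Literature.AlgebraicGeometry.Motives.baseChange F Fi).obj (S.M.obj Kc)).hom (bcSpec Fi ℂ))
  exact AbelianSchemeOver.forall_gal_comp_eq_of_forall_exists_fieldPoint
    (C.𝓜.univ.baseChange (ε.left ≫ pullback.fst C.𝓜.M.hom (bcSpec ℚ Fi))).A _
    (fun σ => (AbelianSchemeOver.pullbackMap_gal_fst_snd _ σ).1) (fun σ => (AbelianSchemeOver.pullbackMap_gal_fst_snd _ σ).2)
    (Y b) (fun σ x0 => exists_fieldPoint_fibre_comp_galA_eq hτE C ε Y hY hR hKc b σ x0) σ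

/-- **The Σ-GAL half closes from the stub** (what merges under the closer's head). [cite: Milne2005ShimuraVarieties, §13 Prop. 13.1 p. 117] -/
theorem sigmaGAL_of_stub :
    ∀ (F : Type) [Field F] [NumberField F] [IsCMField F] [IsGalois ℚ F] (ι₁ : F →+* ℂ)
      (Jstar : Matrix (Fin 2) (Fin 2) F) (_hJ : (Jstar.map (IsCMField.complexConj F))ᵀ = Jstar) (_hJu : IsUnit Jstar)
      (K₀ : C5.OpenCompactSubgroup (GSAdele F Jstar)) (S : RecordSystemGS F Jstar ι₁ K₀) (Kc : C5.SmallLevel K₀)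
      (Fi : Type) [Field Fi] [NumberField Fi] [Algebra F Fi] [IsGalois F Fi] (τE : Fi →+* ℂ) (_hτE : τE.comp (algebraMap F Fi) = ι₁)
      (Φ : Set (F →+* ℂ)) (_hΦ : IsCMTypeThrough ι₁ Φ) (C : AuxChartGS F ι₁ Jstar K₀ S Kc Fi τE Φ)
      (ε : (Literature.AlgebraicGeometry.Motives.baseChange F Fi).obj (S.M.obj Kc) ⟶
          (Literature.AlgebraicGeometry.Motives.baseChange ℚ Fi).obj C.𝓜.M)
      (_hε : letI : Algebra Fi ℂ := τE.toAlgebra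
        ∀ (P : ComplexPoints ((Literature.AlgebraicGeometry.Motives.baseChange F Fi).obj (S.M.obj Kc)))
          (Pflat : letI : Algebra F ℂ := ι₁.toAlgebra; ComplexPoints (S.M.obj Kc)),
          Pflat.left = P.left ≫ pullback.fst (S.M.obj Kc).hom (bcSpec F Fi) →
          (AlgPoints.map ε P).left ≫ pullback.fst C.𝓜.M.hom (bcSpec ℚ Fi) =
            (letI : Algebra F ℂ := ι₁.toAlgebra; (C.f (S.pts Kc Pflat)).left))
      (_hU : Literature.AlgebraicGeometry.ModuliOfAbelianVarieties.siegelUniversalFamilyUniformisation),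

      ∀ Y hY, ReadsCReading C ε Y hY → ReadsCGalois C ε Y hY :=
  readsCGalois_of_readsCReading stub_KCM

end Summit.HodgeConjecture.HodgeConjecture.Cruxes.HLiu418.F0P6aSigmaGAL

end
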